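import Summits.CriticalPhenomena.PercolationContinuityZ3.Theorems.PercNearOneGluingNoHeavyLowerTailAntitheticContractSum
import Summits.CriticalPhenomena.PercolationContinuityZ3.Theorems.PercNearOneGluingNoHeavyLowerTailAntitheticPendant
import HarnessLib

/-!
# `NoHeavyLowerTail` (stmt-CriticalPhenomena-4575) — antithetic cluster pairs: the CHANGE FAMILY of DEG-2 ELIMINATION as a sum over ONE
# sub-cube with PENDANT-LIFTED clusters (prim-hp-2 gen 42; HOME/THEOREM-Cprime-delta2-cycle.md §1, MEMO-gen40 §3)

Support file (`--supports stmt-CriticalPhenomena-4575`, hull-port prover `prim-hp-2`, gen 42).  No definitions, no named facts, no sorries;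
standard axioms.

SETTING (as in …AntitheticContract/…ContractSum): `x ≠ s` meets exactly the pairs `e = xy`, `f = xz` of `E` (`y ≠ z`); `E₀ := E ∖ {e, f}` are
the pairs of `H = G − x`.  The CHANGE PART of `Contract.deg2_decomposition` is the sum of `Δ_E(F,G)` over the constrained colourings with
`e ≢ f`.  This file rewrites it in terms of `H` (CONJECTURE Δ2 of MEMO-gen40 §3 is the statement that it is `≥ 0` when `x ∈ R`):
* `Change.inter_eq_insert`, `Change.compl_inter_eq_insert` — in the sub-cube `e ∈ ω ∌ f` the red pairs of `G` are the red pairs of `H` plus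
  the pendant pair `e` at `y`, the blue ones those of `H` plus the pendant pair `f` at `z`;
* `Change.red_cluster_eq`, `Change.blue_cluster_eq` — hence `C_s(ω ∩ E) = (C_s(ω ∩ E₀))⁺ʸ` and `C_s(ωᶜ ∩ E) = (C_s(ωᶜ ∩ E₀))⁺ᶻ` with the
  pendant lifts `Pendant.liftSet` ("add the marker `e` iff `y` is red-reached", "add `f` iff `z` is blue-reached");
* `Change.reach_iff`, `Change.reach_x_iff` (+ blue versions) — reachability of `r ≠ x` is that of `H`; `x` is red-reached iff `y` is, blue-reached
  iff `z` is;
* `Change.mem_tset_iff` — for `x ∈ R ∖ X`: `ω ∈ tset_E(R,X)` iff `ω ∈ tset_{E₀}(R,X)` and NOT (`y` red-reached ∧ `z` blue-reached) — the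
  "mixed pair constraint" of MEMO-gen40 §3;
* `Change.delta_eq` — `Δ_E(F,G)(ω) = (F(C⁺ʸ) − F(C′⁺ᶻ))(G(C⁺ʸ) − G(C′⁺ᶻ))`;
* `Change.sum_change_eq_two_mul` — by the complement symmetry the change part is twice its `e ∈ ω ∌ f` half;
* `Change.change_nonneg_of_half` — so CONJECTURE Δ2 / THEOREM C′-type results need only the half sub-cube, written over `H` with lifted clusters.
[cite: VandenbergHaggstromKahn2005, §1 p. 3 (open cluster `C_s`)]
-/

noncomputable section

namespace Summit.CriticalPhenomena.PercolationContinuityZ3.Theorems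

open Literature.Probability.Percolation
open scoped Classical symmDiff

namespace Antithetic

namespace Change

variable {V : Type*}

section Generic

/-- `Δ_E` is invariant under swapping the two colours. [this work] -/
theorem delta_compl (F G : Set (Sym2 V) → ℝ) (E : Set (Sym2 V)) (s : V) (ω : Set (Sym2 V)) :
    Peel.delta F G E s ωᶜ = Peel.delta F G E s ω := by
  unfold Peel.delta
  rw [compl_compl]
  ring

/-- The constraint set is invariant under swapping the two colours. [this work] -/
theorem compl_mem_tset_iff [Fintype V] (E : Set (Sym2 V)) (s : V) (R X : Set V) (ω : Set (Sym2 V)) :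
    ωᶜ ∈ Peel.tset E s R X ↔ ω ∈ Peel.tset E s R X := by
  rw [Peel.mem_tset, Peel.mem_tset, compl_compl]
  exact and_congr (forall₂_congr fun r _ => by rw [and_comm]) (forall₂_congr fun v _ => by rw [and_comm])

end Generic

variable {E : Set (Sym2 V)} {s x y z : V} (hxs : x ≠ s) (hxy : x ≠ y) (hxz : x ≠ z)
  (he : s(x, y) ∈ E) (hf : s(x, z) ∈ E) (hdeg : ∀ h ∈ E, x ∈ h → h = s(x, y) ∨ h = s(x, z))

include hdeg in
/-- The pairs of `H = G − x` (those of `E` other than `e, f`) do not meet `x` (vacuous form used by the pendant lemmas). [this work] -/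
theorem noX (η : Set (Sym2 V)) : ∀ h ∈ η ∩ (E \ {s(x, y), s(x, z)}), x ∈ h → h.IsDiag := by
  rintro h ⟨-, hE, hne⟩ hx
  rcases hdeg h hE hx with rfl | rfl
  · exact absurd (Set.mem_insert _ _) hne
  · exact absurd (Set.mem_insert_of_mem _ (Set.mem_singleton _)) hne

include he in
/-- In the sub-cube `e ∈ ω ∌ f`: the red pairs of `E` are the red pairs of `E₀` plus `e`. [this work] -/
theorem inter_eq_insert {ω : Set (Sym2 V)} (hω : s(x, y) ∈ ω) (hω' : s(x, z) ∉ ω) :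
    ω ∩ E = insert s(x, y) (ω ∩ (E \ {s(x, y), s(x, z)})) := by
  ext h
  simp only [Set.mem_inter_iff, Set.mem_insert_iff, Set.mem_sdiff, Set.mem_singleton_iff, not_or]
  constructor
  · rintro ⟨hω1, hE1⟩
    by_cases h1 : h = s(x, y)
    · exact Or.inl h1
    · by_cases h2 : h = s(x, z)
      · exact absurd (h2 ▸ hω1) hω'
      · exact Or.inr ⟨hω1, hE1, h1, h2⟩
  · rintro (rfl | ⟨hω1, hE1, -, -⟩)
    · exact ⟨hω, he⟩
    · exact ⟨hω1, hE1⟩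

include hf in
/-- In the sub-cube `e ∈ ω ∌ f`: the blue pairs of `E` are the blue pairs of `E₀` plus `f`. [this work] -/
theorem compl_inter_eq_insert {ω : Set (Sym2 V)} (hω : s(x, y) ∈ ω) (hω' : s(x, z) ∉ ω) :
    ωᶜ ∩ E = insert s(x, z) (ωᶜ ∩ (E \ {s(x, y), s(x, z)})) := by
  ext h
  simp only [Set.mem_inter_iff, Set.mem_insert_iff, Set.mem_sdiff, Set.mem_singleton_iff, not_or, Set.mem_compl_iff]
  constructor
  · rintro ⟨hω1, hE1⟩
    by_cases h2 : h = s(x, z)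
    · exact Or.inl h2
    · by_cases h1 : h = s(x, y)
      · exact absurd (h1 ▸ hω) hω1
      · exact Or.inr ⟨hω1, hE1, h1, h2⟩
  · rintro (rfl | ⟨hω1, hE1, -, -⟩)
    · exact ⟨hω', hf⟩
    · exact ⟨hω1, hE1⟩

include hxs hxy he hdeg in
/-- **Red cluster in the sub-cube** `e ∈ ω ∌ f`: `C_s(ω ∩ E) = (C_s(ω ∩ E₀))⁺` — the pendant lift at `y` by the marker `e`. [this work] -/
theorem red_cluster_eq {ω : Set (Sym2 V)} (hω : s(x, y) ∈ ω) (hω' : s(x, z) ∉ ω) :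
    openEdgeCluster (ω ∩ E) s = Pendant.liftSet s y s(x, y) (openEdgeCluster (ω ∩ (E \ {s(x, y), s(x, z)})) s) := by
  have h := Pendant.openEdgeCluster_insert s y x (ω ∩ (E \ {s(x, y), s(x, z)})) (noX hdeg ω) hxy.symm hxs.symm
  rw [Sym2.eq_swap (a := y) (b := x)] at h
  rw [inter_eq_insert he hω hω']
  exact h

include hxs hxz hf hdeg in
/-- **Blue cluster in the sub-cube** `e ∈ ω ∌ f`: `C_s(ωᶜ ∩ E) = (C_s(ωᶜ ∩ E₀))⁺` — the pendant lift at `z` by the marker `f`. [this work] -/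
theorem blue_cluster_eq {ω : Set (Sym2 V)} (hω : s(x, y) ∈ ω) (hω' : s(x, z) ∉ ω) :
    openEdgeCluster (ωᶜ ∩ E) s = Pendant.liftSet s z s(x, z) (openEdgeCluster (ωᶜ ∩ (E \ {s(x, y), s(x, z)})) s) := by
  have h := Pendant.openEdgeCluster_insert s z x (ωᶜ ∩ (E \ {s(x, y), s(x, z)})) (noX hdeg ωᶜ) hxz.symm hxs.symm
  rw [Sym2.eq_swap (a := z) (b := x)] at h
  rw [compl_inter_eq_insert hf hω hω']
  exact h

include hxs hxy he hdeg in
/-- Red reachability of a vertex `r ≠ x` in the sub-cube is red reachability in `H`. [this work] -/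
theorem reach_iff {ω : Set (Sym2 V)} (hω : s(x, y) ∈ ω) (hω' : s(x, z) ∉ ω) {r : V} (hr : r ≠ x) :
    (openGraph (ω ∩ E)).Reachable s r ↔ (openGraph (ω ∩ (E \ {s(x, y), s(x, z)}))).Reachable s r := by
  have h := Pendant.reachable_iff (ω ∩ (E \ {s(x, y), s(x, z)})) y x (noX hdeg ω) hxy.symm hxs.symm hr
  rw [Sym2.eq_swap (a := y) (b := x)] at h
  rw [inter_eq_insert he hω hω']
  exact h

include hxs hxz hf hdeg in
/-- Blue reachability of a vertex `r ≠ x` in the sub-cube is blue reachability in `H`. [this work] -/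
theorem reach_compl_iff {ω : Set (Sym2 V)} (hω : s(x, y) ∈ ω) (hω' : s(x, z) ∉ ω) {r : V} (hr : r ≠ x) :
    (openGraph (ωᶜ ∩ E)).Reachable s r ↔ (openGraph (ωᶜ ∩ (E \ {s(x, y), s(x, z)}))).Reachable s r := by
  have h := Pendant.reachable_iff (ωᶜ ∩ (E \ {s(x, y), s(x, z)})) z x (noX hdeg ωᶜ) hxz.symm hxs.symm hr
  rw [Sym2.eq_swap (a := z) (b := x)] at h
  rw [compl_inter_eq_insert hf hω hω']
  exact h

include hxs hxy he hdeg in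
/-- In the sub-cube, `x` is red-reached iff `y` is red-reached in `H`. [this work] -/
theorem reach_x_iff {ω : Set (Sym2 V)} (hω : s(x, y) ∈ ω) (hω' : s(x, z) ∉ ω) :
    (openGraph (ω ∩ E)).Reachable s x ↔ (openGraph (ω ∩ (E \ {s(x, y), s(x, z)}))).Reachable s y := by
  have h := Pendant.reachable_leaf_iff (ω ∩ (E \ {s(x, y), s(x, z)})) y x (noX hdeg ω) hxy.symm hxs.symm
  rw [Sym2.eq_swap (a := y) (b := x)] at h
  rw [inter_eq_insert he hω hω']
  exact h

include hxs hxz hf hdeg in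
/-- In the sub-cube, `x` is blue-reached iff `z` is blue-reached in `H`. [this work] -/
theorem reach_compl_x_iff {ω : Set (Sym2 V)} (hω : s(x, y) ∈ ω) (hω' : s(x, z) ∉ ω) :
    (openGraph (ωᶜ ∩ E)).Reachable s x ↔ (openGraph (ωᶜ ∩ (E \ {s(x, y), s(x, z)}))).Reachable s z := by
  have h := Pendant.reachable_leaf_iff (ωᶜ ∩ (E \ {s(x, y), s(x, z)})) z x (noX hdeg ωᶜ) hxz.symm hxs.symm
  rw [Sym2.eq_swap (a := z) (b := x)] at h
  rw [compl_inter_eq_insert hf hω hω']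
  exact h

include hxs hdeg in
/-- `x` is never reached in `H` (it meets no pair of `E₀`). [this work] -/
theorem not_reach_x (η : Set (Sym2 V)) : ¬ (openGraph (η ∩ (E \ {s(x, y), s(x, z)}))).Reachable s x :=
  Pendant.not_reachable_leaf _ x (noX hdeg η) hxs.symm

include hxs hxy hxz he hf hdeg in
/-- **Constraints in the sub-cube.**  For `x ∈ R`, `x ∉ X` and `e ∈ ω ∌ f`: `ω ∈ tset_E(R,X)` iff `ω ∈ tset_{E₀}(R,X)` and NOT (`y` red-reached
and `z` blue-reached in `H`) — the mixed pair constraint. [this work] -/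
theorem mem_tset_iff [Fintype V] (R X : Set V) (hxR : x ∈ R) (hxX : x ∉ X) {ω : Set (Sym2 V)} (hω : s(x, y) ∈ ω)
    (hω' : s(x, z) ∉ ω) :
    ω ∈ Peel.tset E s R X ↔
      ω ∈ Peel.tset (E \ {s(x, y), s(x, z)}) s R X ∧
        ¬ ((openGraph (ω ∩ (E \ {s(x, y), s(x, z)}))).Reachable s y ∧
            (openGraph (ωᶜ ∩ (E \ {s(x, y), s(x, z)}))).Reachable s z) := by
  rw [Peel.mem_tset, Peel.mem_tset]
  have hX' : ∀ v ∈ X, v ≠ x := fun v hv h => hxX (h ▸ hv)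
  have A := fun (r : V) (hr : r ≠ x) => reach_iff hxs hxy he hdeg hω hω' hr
  have B := fun (r : V) (hr : r ≠ x) => reach_compl_iff hxs hxz hf hdeg hω hω' hr
  have Ax := reach_x_iff hxs hxy he hdeg hω hω'
  have Bx := reach_compl_x_iff hxs hxz hf hdeg hω hω'
  constructor
  · rintro ⟨hR, hXc⟩
    refine ⟨⟨fun r hr => ?_, fun v hv => ?_⟩, ?_⟩
    · by_cases hrx : r = x
      · subst hrx
        exact fun h => not_reach_x hxs hdeg ω h.1
      · rw [← A r hrx, ← B r hrx]
        exact hR r hr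
    · rw [← A v (hX' v hv), ← B v (hX' v hv)]
      exact hXc v hv
    · rw [← Ax, ← Bx]
      exact hR x hxR
  · rintro ⟨⟨hR, hXc⟩, hyz'⟩
    refine ⟨fun r hr => ?_, fun v hv => ?_⟩
    · by_cases hrx : r = x
      · subst hrx
        rw [Ax, Bx]
        exact hyz'
      · rw [A r hrx, B r hrx]
        exact hR r hr
    · rw [A v (hX' v hv), B v (hX' v hv)]
      exact hXc v hv

include hxs hxy hxz he hf hdeg in
/-- **The functional in the sub-cube**: `Δ_E(F,G)(ω) = (F(C⁺ʸ) − F(C′⁺ᶻ))(G(C⁺ʸ) − G(C′⁺ᶻ))` with `C, C′` the clusters of `H`. [this work] -/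
theorem delta_eq (F G : Set (Sym2 V) → ℝ) {ω : Set (Sym2 V)} (hω : s(x, y) ∈ ω) (hω' : s(x, z) ∉ ω) :
    Peel.delta F G E s ω =
      (F (Pendant.liftSet s y s(x, y) (openEdgeCluster (ω ∩ (E \ {s(x, y), s(x, z)})) s)) -
          F (Pendant.liftSet s z s(x, z) (openEdgeCluster (ωᶜ ∩ (E \ {s(x, y), s(x, z)})) s))) *
        (G (Pendant.liftSet s y s(x, y) (openEdgeCluster (ω ∩ (E \ {s(x, y), s(x, z)})) s)) -
          G (Pendant.liftSet s z s(x, z) (openEdgeCluster (ωᶜ ∩ (E \ {s(x, y), s(x, z)})) s))) := by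
  unfold Peel.delta
  rw [red_cluster_eq hxs hxy he hdeg hω hω', blue_cluster_eq hxs hxz hf hdeg hω hω']

/-- **The change part is twice its half**: by the colour-swap symmetry,
`Σ_{tset, e ≢ f} Δ = 2 · Σ_{tset, e ∈ ω ∌ f} Δ`. [this work] -/
theorem sum_change_eq_two_mul [Fintype V] (F G : Set (Sym2 V) → ℝ) (R X : Set V) :
    ∑ ω ∈ (Peel.tset E s R X).filter (fun ω => ¬ (s(x, y) ∈ ω ↔ s(x, z) ∈ ω)), Peel.delta F G E s ω =
      2 * ∑ ω ∈ (Peel.tset E s R X).filter (fun ω => s(x, y) ∈ ω ∧ s(x, z) ∉ ω), Peel.delta F G E s ω := by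
  have hsplit : (Peel.tset E s R X).filter (fun ω => ¬ (s(x, y) ∈ ω ↔ s(x, z) ∈ ω)) =
      (Peel.tset E s R X).filter (fun ω => s(x, y) ∈ ω ∧ s(x, z) ∉ ω) ∪
        (Peel.tset E s R X).filter (fun ω => s(x, y) ∉ ω ∧ s(x, z) ∈ ω) := by
    ext ω
    simp only [Finset.mem_filter, Finset.mem_union]
    tauto
  have hdisj : Disjoint ((Peel.tset E s R X).filter (fun ω => s(x, y) ∈ ω ∧ s(x, z) ∉ ω))
      ((Peel.tset E s R X).filter (fun ω => s(x, y) ∉ ω ∧ s(x, z) ∈ ω)) := by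
    rw [Finset.disjoint_filter]
    exact fun ω _ h1 h2 => h2.1 h1.1
  rw [hsplit, Finset.sum_union hdisj, two_mul]
  congr 1
  refine Finset.sum_nbij' (fun ω => ωᶜ) (fun ω => ωᶜ) (fun ω hω => ?_) (fun ω hω => ?_) (fun ω _ => compl_compl ω)
    (fun ω _ => compl_compl ω) (fun ω _ => (delta_compl F G E s ω).symm)
  · rw [Finset.mem_filter] at hω ⊢
    exact ⟨(compl_mem_tset_iff E s R X ω).2 hω.1, hω.2.1, fun h => h hω.2.2⟩
  · rw [Finset.mem_filter] at hω ⊢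
    exact ⟨(compl_mem_tset_iff E s R X ω).2 hω.1, fun h => h hω.2.1, hω.2.2⟩

include hxs hxy hxz he hf hdeg in
/-- **The half change sum over `H`.**  For `x ∈ R ∖ X`:
`Σ_{ω ∈ tset_E(R,X), e ∈ ω ∌ f} Δ_E(F,G)(ω) = Σ_{ω ∈ tset_{E₀}(R,X), e ∈ ω ∌ f, ¬(y red ∧ z blue)} (F(C⁺ʸ) − F(C′⁺ᶻ))(G(C⁺ʸ) − G(C′⁺ᶻ))`
(both sums over all `ω : Set (Sym2 V)`; `C, C′` the clusters of `ω` on `E₀`). [this work] -/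
theorem sum_half_eq [Fintype V] (F G : Set (Sym2 V) → ℝ) (R X : Set V) (hxR : x ∈ R) (hxX : x ∉ X) :
    ∑ ω ∈ (Peel.tset E s R X).filter (fun ω => s(x, y) ∈ ω ∧ s(x, z) ∉ ω), Peel.delta F G E s ω =
      ∑ ω ∈ (Peel.tset (E \ {s(x, y), s(x, z)}) s R X).filter (fun ω => s(x, y) ∈ ω ∧ s(x, z) ∉ ω ∧
          ¬ ((openGraph (ω ∩ (E \ {s(x, y), s(x, z)}))).Reachable s y ∧
              (openGraph (ωᶜ ∩ (E \ {s(x, y), s(x, z)}))).Reachable s z)),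
        (F (Pendant.liftSet s y s(x, y) (openEdgeCluster (ω ∩ (E \ {s(x, y), s(x, z)})) s)) -
            F (Pendant.liftSet s z s(x, z) (openEdgeCluster (ωᶜ ∩ (E \ {s(x, y), s(x, z)})) s))) *
          (G (Pendant.liftSet s y s(x, y) (openEdgeCluster (ω ∩ (E \ {s(x, y), s(x, z)})) s)) -
            G (Pendant.liftSet s z s(x, z) (openEdgeCluster (ωᶜ ∩ (E \ {s(x, y), s(x, z)})) s))) := by
  have hset : (Peel.tset E s R X).filter (fun ω => s(x, y) ∈ ω ∧ s(x, z) ∉ ω) =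
      (Peel.tset (E \ {s(x, y), s(x, z)}) s R X).filter (fun ω => s(x, y) ∈ ω ∧ s(x, z) ∉ ω ∧
          ¬ ((openGraph (ω ∩ (E \ {s(x, y), s(x, z)}))).Reachable s y ∧
              (openGraph (ωᶜ ∩ (E \ {s(x, y), s(x, z)}))).Reachable s z)) := by
    ext ω
    simp only [Finset.mem_filter]
    constructor
    · rintro ⟨hT, hω, hω'⟩
      have h := (mem_tset_iff hxs hxy hxz he hf hdeg R X hxR hxX hω hω').1 hT
      exact ⟨h.1, hω, hω', h.2⟩
    · rintro ⟨hT, hω, hω', hc⟩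
      exact ⟨(mem_tset_iff hxs hxy hxz he hf hdeg R X hxR hxX hω hω').2 ⟨hT, hc⟩, hω, hω'⟩
  rw [hset]
  refine Finset.sum_congr rfl fun ω hω => ?_
  rw [Finset.mem_filter] at hω
  exact delta_eq hxs hxy hxz he hf hdeg F G hω.2.1 hω.2.2.1

include hxs hxy hxz he hf hdeg in
/-- **CONJECTURE Δ2 reduces to the half sub-cube over `H`**: if the lifted half sum of `sum_half_eq` is nonnegative then so is the change
part of `Contract.deg2_decomposition` (hypothesis `hchg` of `Contract.good_of_change_nonneg`). [this work] -/
theorem change_nonneg_of_half [Fintype V] (F G : Set (Sym2 V) → ℝ) (R X : Set V) (hxR : x ∈ R) (hxX : x ∉ X)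
    (h : 0 ≤ ∑ ω ∈ (Peel.tset (E \ {s(x, y), s(x, z)}) s R X).filter (fun ω => s(x, y) ∈ ω ∧ s(x, z) ∉ ω ∧
          ¬ ((openGraph (ω ∩ (E \ {s(x, y), s(x, z)}))).Reachable s y ∧
              (openGraph (ωᶜ ∩ (E \ {s(x, y), s(x, z)}))).Reachable s z)),
        (F (Pendant.liftSet s y s(x, y) (openEdgeCluster (ω ∩ (E \ {s(x, y), s(x, z)})) s)) -
            F (Pendant.liftSet s z s(x, z) (openEdgeCluster (ωᶜ ∩ (E \ {s(x, y), s(x, z)})) s))) *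
          (G (Pendant.liftSet s y s(x, y) (openEdgeCluster (ω ∩ (E \ {s(x, y), s(x, z)})) s)) -
            G (Pendant.liftSet s z s(x, z) (openEdgeCluster (ωᶜ ∩ (E \ {s(x, y), s(x, z)})) s)))) :
    0 ≤ ∑ ω ∈ (Peel.tset E s R X).filter (fun ω => ¬ (s(x, y) ∈ ω ↔ s(x, z) ∈ ω)), Peel.delta F G E s ω := by
  rw [sum_change_eq_two_mul F G R X, sum_half_eq hxs hxy hxz he hf hdeg F G R X hxR hxX]
  exact mul_nonneg zero_le_two h

end Change

end Antithetic

end Summit.CriticalPhenomena.PercolationContinuityZ3.Theorems
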